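import Summits.ValiantsHypothesis.ValiantsHypothesis.Theorems.NewtonUnitEquationsTwoProductsTowerRecordLiftRecord
import Summits.ValiantsHypothesis.ValiantsHypothesis.Theorems.NewtonUnitEquationsTwoProductsTowerRecordCount
import Summits.ValiantsHypothesis.ValiantsHypothesis.Theorems.NewtonUnitEquationsTwoProductsTowerRecordLevels

/-!
# R13 — THE TOWER-CARRIER CLASS RUNGS, PROVED: `TowerCarrierLaw` and the height-free `SparseLevelCarrierLaw ℓ`; R12 ⊆ R13 by name

The compositions (val-lit-p3 g18): coefficient-side laws of val-idea-37 g4 (✓ `…TowerRecordCount :: towerRecordLaw_holds` (18,2)×(D+1),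
✓ `…TowerRecordLevels :: sparseLevelRecordLaw_holds` a(ℓ) = 4ℓ²+10ℓ+16) ∘ the degree-`D` Lift (✓ `…TowerRecordLiftRecord ::
Lift.towerCarrier_of_towerRecord_holds`, `Lift.sparseLevelCarrier_of_sparseLevelRecord_holds`):
* ★★ `towerCarrierLaw_holds : TowerCarrierLaw` — every normalised `t`-sparse instance of `m` factor pairs whose tail alphabet lies in a tower
  `X ⊔ (X+d) ⊔ … ⊔ (X+D•d)` (carriers `x : Fin n → ℕ²`, ONE shift `d ∈ ℤ²`), tower-dissociated to depth `(m, D)`, obeys the per-cell law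
  `#S ≤ 2^{18 m}(t+2)²(D+1)` for every `IsCellFamily` `S`;
* ★★ `sparseLevelCarrierLaw_holds (ℓ) : SparseLevelCarrierLaw ℓ` — the same with levels in any `E ⊆ [0,D]`, `|E| ≤ ℓ`: `#S ≤ 2^{a(ℓ) m}(t+2)²`,
  HEIGHT-FREE (`sparseLevelRecordLaw_all`: the law for every `ℓ`, by monotonicity in `ℓ` from `ℓ ≥ 1`);
* `towerDissociated_one_iff`, ★ `shiftedCarrier_of_towerCarrier_holds : shiftedCarrier_of_towerCarrier` (R12 ⊆ R13 BY NAME: at `D = 1` the alphabet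
  clause is R12's, `TowerDissociated … 1 ↔ CarrierDissociated`, `(D+1) = 2 ≤ t+2` absorbed into `b+1`); the composition
  `shiftedCarrier_of_towerCarrier_holds towerCarrierLaw_holds` is a second kernel route to ✓ `MomentRecord.shiftedCarrierLaw_holds` (not restated: dedup).
HONEST LABEL (val-idea-crit-8 g2 VERDICT #19, binding): R13 = a WIDER CLASS RUNG of the relation ladder (dense PARALLEL towers of height `D` on
dissociated carriers; in 5906's currency while `D+1 ≤ 2^{O(m)}·poly t`; the sparse-level form is in currency exactly for BOUNDEDLY MANY levels
`ℓ ≤ C`), INERT AS A HATCH — it does not feed `PlanarCellBound` off the class; the collinear digit towers of Disproof F10 (`ℓ = t`, fibre lumping)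
are NOT covered; `ResidualLawV24` ⟺ `PlanarCellBound`, the crux `…Theses.NewtonUnitEquations.TwoProducts` (stmt-5906), V0/V1/V6, every `closes`
binder and every summit statement are UNMOVED; summit-progress accounting +0; VP ≠ VNP is NOT proved.
Credit: coefficient laws + typed class targets val-idea-37 g4; critic/text owner val-idea-crit-8 g2; R12 vocabulary crit-8 g2; transplant + Lift +
composition val-lit-p3 g18 (Lift architecture val-lit-p3 g17).  Helper on `stmt-ValiantsHypothesis-5906` (`--supports`), closes nothing.
No instances, no notation, no named facts. [folklore]
-/

set_option linter.dupNamespace false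

noncomputable section

open Classical

namespace Summit.ValiantsHypothesis.ValiantsHypothesis.Theorems.NewtonUnitEquations.TwoProducts.TowerRecord
open scoped BigOperators
open MvPolynomial
open Summit.ValiantsHypothesis.ValiantsHypothesis.Theorems.NewtonUnitEquations.TwoProducts.FormalLogLinearisation
open Summit.ValiantsHypothesis.ValiantsHypothesis.Theorems.NewtonUnitEquations.TwoProducts.PlanarCell
open Summit.ValiantsHypothesis.ValiantsHypothesis.Theorems.NewtonUnitEquations.TwoProducts.MomentRecord

variable {m n : ℕ}

/-- ★★ **THE TOWER-CARRIER LAW (B_D), PROVED** — `(a, b) = (18, 2)`, times `(D+1)`: tail alphabet in `X ⊔ (X+d) ⊔ … ⊔ (X+D•d)`, tower-dissociated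
to depth `(m, D)` ⇒ per-cell law.  HONEST LABEL: a wider CLASS rung, inert as a hatch; not `PlanarCellBound`, not the crux; VP ≠ VNP NOT proved. [folklore] -/
theorem towerCarrierLaw_holds : TowerCarrierLaw :=
  Lift.towerCarrier_of_towerRecord_holds towerRecordLaw_holds

/-- The sparse-level record law is monotone in the level budget `ℓ`. [folklore] -/
theorem sparseLevelRecordLaw_mono {ℓ ℓ' : ℕ} (h : ℓ ≤ ℓ') (hlaw : SparseLevelRecordLaw ℓ') : SparseLevelRecordLaw ℓ := by
  obtain ⟨a, b, hab⟩ := hlaw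
  exact ⟨a, b, fun m n t D γ γ' x d E hE => hab m n t D γ γ' x d E (hE.trans h)⟩

/-- The sparse-level record law for EVERY `ℓ` (for `ℓ = 0` via `ℓ = 1`). [folklore] -/
theorem sparseLevelRecordLaw_all (ℓ : ℕ) : SparseLevelRecordLaw ℓ :=
  sparseLevelRecordLaw_mono (le_max_left ℓ 1) (sparseLevelRecordLaw_holds (max ℓ 1) (le_max_right ℓ 1))

/-- ★★ **THE SPARSE-LEVEL CARRIER LAW (B_E), PROVED for every `ℓ`** — tail alphabet in `⊔_{j ∈ E}(X + j•d)`, `|E| ≤ ℓ`, `E ⊆ [0, D]`, tower-dissociated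
to depth `(m, D)` ⇒ per-cell law `≤ 2^{a(ℓ) m}(t+2)^2`, `a(ℓ) = 4ℓ'²+10ℓ'+16` with `ℓ' = max ℓ 1` — the height `D` does NOT enter the bound.
HONEST LABEL: in 5906's currency exactly for boundedly many levels; a wider CLASS rung, inert as a hatch; VP ≠ VNP NOT proved. [folklore] -/
theorem sparseLevelCarrierLaw_holds (ℓ : ℕ) : SparseLevelCarrierLaw ℓ :=
  Lift.sparseLevelCarrier_of_sparseLevelRecord_holds ℓ (sparseLevelRecordLaw_all ℓ)

/-! ## R12 ⊆ R13 by name -/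

/-- At `D = 1` tower dissociation is R12's carrier dissociation (both: `(S,k) ↦ S•x + k•d` injective on `|S| ≤ m`, `k ≤ |S|`). [folklore] -/
theorem towerDissociated_one_iff (x : Fin n → Expo) (d : Fin 2 → ℤ) (m : ℕ) :
    TowerDissociated x d m 1 ↔ CarrierDissociated x d m := by
  simp only [TowerDissociated, CarrierDissociated, one_mul]

/-- At `D = 1` R12's alphabet clause `e = x_i ∨ e = x_i + d` gives the tower clause `∃ i j, j ≤ 1 ∧ e = x_i + j•d`. [folklore] -/
theorem towerClause_of_shiftedClause {u v : Fin m → MvPolynomial (Fin 2) ℂ} {x : Fin n → Expo} {d : Fin 2 → ℤ}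
    (halph : ∀ e ∈ tailSupport u v, ∃ i, e = x i ∨ ∀ c, ((e c : ℕ) : ℤ) = shiftZ x d i c) :
    ∀ e ∈ tailSupport u v, ∃ i : Fin n, ∃ j : ℕ, j ≤ 1 ∧ ∀ c, ((e c : ℕ) : ℤ) = ((x i c : ℕ) : ℤ) + (j : ℤ) * d c := by
  intro e he
  obtain ⟨i, h | h⟩ := halph e he
  · exact ⟨i, 0, zero_le_one, fun c => by rw [h]; simp⟩
  · exact ⟨i, 1, le_rfl, fun c => by rw [h c, shiftZ]; simp⟩

/-- ★ **R12 ⊆ R13 BY NAME: `TowerCarrierLaw → MomentRecord.ShiftedCarrierLaw`** (typed target `shiftedCarrier_of_towerCarrier` of ✓ `…TowerRecordDefs`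
§9b; constants `(a, b) ↦ (a, b+1)`, the factor `(D+1) = 2 ≤ t+2` absorbed). [folklore] -/
theorem shiftedCarrier_of_towerCarrier_holds : shiftedCarrier_of_towerCarrier := by
  rintro ⟨a, b, hT⟩
  refine ⟨a, b + 1, fun m t n u v x d ht hu hv halph hdis R S hS => ?_⟩
  have h := hT m t n 1 u v x d ht hu hv (towerClause_of_shiftedClause halph) ((towerDissociated_one_iff x d m).mpr hdis) R S hS
  calc S.card ≤ 2 ^ (a * m) * (t + 2) ^ b * (1 + 1) := h
    _ ≤ 2 ^ (a * m) * (t + 2) ^ b * (t + 2) := Nat.mul_le_mul_left _ (by omega)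
    _ = 2 ^ (a * m) * (t + 2) ^ (b + 1) := by rw [pow_succ, mul_assoc]

end Summit.ValiantsHypothesis.ValiantsHypothesis.Theorems.NewtonUnitEquations.TwoProducts.TowerRecord

end
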